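import Summits.AnomalousDissipation.AnomalousDissipation.Theorems.MomentParityUniformResolutionStubClosure

/-!
# `MomentParity.UniformResolution` (stmt-AnomalousDissipation-14330), line `Sketch`:
# the existential form follows from the universal one — `ResolvedDissipation → UniformResolution`

Support file of the line lead (prover-line-stmt-AnomalousDissipation-14330-0). The route header (MomentParity
rev 13, § RANKED, #9 UniformResolution; KILL CRITERIA) records that `UniformResolution` is the existential twin
of the crux `ResolvedDissipation` along the loud family and that "ResolvedDissipation ∧ MomentClosure ⇒
UniformResolution modulo two bookkeeping lemmas". With the landed stub S1 of the line
(`MomentParityUniformResolution.stub_closure`: closure in the moment order with POLYNOMIAL all-order output,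
no `κ` clause) no bookkeeping is left: at each `j` and each of the frequently-many levels the `d`-wise loud laws
close to ONE loud law polynomially stationary at every order, which is exactly the hypothesis of
`ResolvedDissipation` at `(f, ν_j, R_j)`; its schedule `κ_j` resolves that law, and the budgets are unchanged
(`E′ = E`, `ε′ = ε`). Contrapositive (the route's kill bookkeeping): `¬ UniformResolution → ¬ ResolvedDissipation`.

* `uniformResolution_of_resolvedDissipation : ResolvedDissipation → UniformResolution` (registered sub-goal of
  stmt-AnomalousDissipation-14330; a CONDITIONAL proof of the item on the open crux stmt-AnomalousDissipation-14284,
  not a proof of the item).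
-/

noncomputable section

-- `Summit.<Summit>.<Problem>` duplicate namespace is the tree's mandated layout for single-conjunct summits.
set_option linter.dupNamespace false

namespace Summit.AnomalousDissipation.AnomalousDissipation.Theorems.MomentParityUniformResolution

open MeasureTheory Filter Topology
open Literature.Analysis.FunctionSpaces Literature.Analysis.FluidPDE
open Summit.AnomalousDissipation.AnomalousDissipation.Theses.MomentParity
open Summit.AnomalousDissipation.AnomalousDissipation.Theorems.QuarticGate.Negative

/-- **`ResolvedDissipation → UniformResolution`** (registered sub-goal `uniformResolution_of_resolvedDissipation`
of stmt-AnomalousDissipation-14330). Fix `f, ν, E, ε` and the antecedent of `UniformResolution`; keep the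
budgets (`E′ = E`, `ε′ = ε`). At each `j` take the antecedent's radius `R` and the schedule `κ` that
`ResolvedDissipation` assigns to `(f, ν j, R)`; at each of the frequently-many levels `N`, S1
(`stub_closure`) closes the `d`-wise loud laws into one loud law in the same ball, polynomially stationary at
every order — hence resolved by `κ` (the stationarity hypothesis of `ResolvedDissipation` is all-order
polynomial stationarity) and `d`-stationary for every `d`. [folklore] -/
theorem uniformResolution_of_resolvedDissipation : Summit.AnomalousDissipation.AnomalousDissipation.Theses.MomentParity.ResolvedDissipation → Summit.AnomalousDissipation.AnomalousDissipation.Theses.MomentParity.UniformResolution := by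
  intro hRD f hfs hfd hfz ν E ε hν _hν0 hε hhyp
  refine ⟨E, ε, hε, fun j => ?_⟩
  obtain ⟨R, hfreq⟩ := hhyp j
  obtain ⟨κ, hκ⟩ := hRD f hfs hfd hfz (ν j) (hν j) R
  refine ⟨R, κ, hfreq.mono fun N hN d => ?_⟩
  obtain ⟨μ, hp, hl, hb, hst, hE, hD⟩ := stub_closure f hfs (ν j) N E ε R hN
  exact ⟨μ, hp, hl, hb, hκ N μ hp hl hb (fun m g P hg => hst (P.totalDegree + 1) m g P hg le_rfl),
    hst d, hE, hD⟩

end Summit.AnomalousDissipation.AnomalousDissipation.Theorems.MomentParityUniformResolution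

end
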